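import Summits.Langlands.Langlands.Theses.HolomorphicLimitSplit

/-!
# Glue of the Artin–analytic split of `NonLimitIrregularAutomorphy` (host route HolomorphicLimitSplit)

Closes the glue item of the split `NonLimitIrregularAutomorphy ⟸ TwistedArtinFinitePoles ∧ UnramifiedPoleBootstrap ∧ NonArtinDarkAutomorphy ∧ ArtinConverseDictionary ∧ ArtinMoveTransport`
(`NonLimitIrregularAutomorphy_of_artinsplit : TwistedArtinFinitePoles → UnramifiedPoleBootstrap → NonArtinDarkAutomorphy → ArtinConverseDictionary → ArtinMoveTransport → NonLimitIrregularAutomorphy`), generated by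
`ledger route edit route-Langlands-HolomorphicLimitSplit --split NonLimitIrregularAutomorphy --into children.json --glue-decl-name NonLimitIrregularAutomorphy_of_artinsplit`.
Pure logic — excluded middle on the inlined Artin-move dial ARTMOVE(ρ/K) (the parent's MOVE template with «R′ HT-regular» replaced by
«rank R′ = 2 ∧ R′ finite image ∧ R′ not totally odd»): no Artin move ⇒ `NonArtinDarkAutomorphy`; otherwise the even-Artin avatar R′ over
the totally real F₁ is weakly automorphic (directly, or from finitely-many-poles ⇒ entire unramified twists ⇒ the Booker–Krishnamurthy
dictionary) and `ArtinMoveTransport` carries automorphy back to ρ.  This is the lens-3 g9 node proof (decomp-langlands, 2026-08-30;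
certified as `NonLimitIrregularAutomorphy_of_artinsplit_proof` in the node's kit check `nodes/lens-3-g9-ArtinAnalyticSplit.kit_check_split.lean`), transported
verbatim to the tree's declarations.  No definitions.
-/

set_option linter.dupNamespace false -- project-wide option; `Summit.Langlands.Langlands` is the mandated namespace

namespace Summit.Langlands.Langlands.Theorems

open Summit.Langlands.Langlands.Theses.HolomorphicLimitSplit in
/-- The glue item of the Artin–analytic split of `NonLimitIrregularAutomorphy` (NL_TR) on route HolomorphicLimitSplit: the
children imply the parent (excluded middle on the Artin move). -/
theorem NonLimitIrregularAutomorphy_of_artinsplit_proof :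
    Summit.Langlands.Langlands.Theses.HolomorphicLimitSplit.NonLimitIrregularAutomorphy_of_artinsplit := by
  intro hFP hBOOT hNLD hJLBK hAMT K _ _ hK n hcpt hn ℓ _ ι ρ hirr hgeo hnm hnlim
  -- excluded middle on the inlined Artin move ARTMOVE(ρ/K): no Artin move ⇒ the residual child NLD applies verbatim
  refine (Classical.em _).elim (fun hart => ?_) (fun hnart => hNLD K hK n hcpt hn ℓ ι ρ hirr hgeo hnm hnlim hnart)
  obtain ⟨M, E₀, i₁, i₂, i₃, i₄, i₅, i₆, i₇, i₈, i₉, hsolv₀, F₁, E₁, j₁, j₂, j₃, j₄, j₅, j₆, j₇, j₈, j₉, hF₁, hsolv₁,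
    m, θ, hm, hθirr, hθρ, χ, n', R', hn', hR'irr, hR'geo, h2, hfin, hnodd, hθχ⟩ := hart
  -- the even-Artin avatar R' over the totally real F₁: finitely many poles for every unramified twist (FP) ⇒ entire twists (BOOT)
  -- ⇒ weak automorphy of R' (JLBK, the Booker–Krishnamurthy dictionary); AMT transports automorphy back along the move to ρ
  exact hAMT K n ℓ ι ρ hirr hgeo hn M E₀ hsolv₀ F₁ E₁ hsolv₁ hF₁ m θ hm hθirr hθρ χ n' R' hn' hR'irr hR'geo h2 hfin hnodd hθχ
    (hJLBK F₁ hF₁ n' ℓ ι R' hR'irr hR'geo h2 hfin hnodd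
      (hBOOT F₁ hF₁ n' ℓ ι R' hR'irr hR'geo h2 hfin hnodd (hFP F₁ hF₁ n' ℓ ι R' hR'irr hR'geo h2 hfin hnodd))) hcpt

end Summit.Langlands.Langlands.Theorems
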